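import Summits.BirchSwinnertonDyer.BirchSwinnertonDyer.Theorems.ManinLocalTwoThreeIstarDeepNormalForm
import HarnessLib

/-!
# The Papadopoulos menu at `2` for type `Iₙ*` (`n ≥ 1`): the exact values of `ord Δ` on the exit shapes of the `Iₙ*` loop, `2` a uniformiser
# (route `ManinLocalTwoThree`, crux C2 `ManinOddAtFour` stmt-BirchSwinnertonDyer-22967; cell bsd-f2-manin, p3 gen 12)

The tree's `KodairaDiscriminantValuesTwoProofs` records the exact `ord Δ` value sets at an absolutely unramified `2`-adic place for the types
`II {4,6,7}`, `III {4,6,8,9}`, `IV {4}`, `I₀* {8,9,10}`, `IV* {8}`, `III* {10,12,14,15}`, `II* {11,12,14}`; for `Iₙ*`, `n ≥ 1`, only the bound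
`ord Δ ≤ n + 11` (`addVal_Δ_toNat_le_of_istarA/B`, whose proofs compute the exact values but export the bound).  This file exports the exact
values on the two exit shapes (§1: the identities of those proofs, verbatim) and, through this seat's deep normal form with exit witness
(`exists_smul_deep_of_kodairaSymbolOfMinimal_eq_Istar`), the value sets **`I₁* {8}`, `I₂* {10,12,13}`, `I₃* {11,12}`, `Iₙ* {n+8, n+10}` (`n ≥ 4`)**
(§2) — Papadopoulos 1993, Table IV (`p = 2`).  Consumers: the type lists for `f₂ ∈ {5,6,7,8}` (sibling `…ConductorExponentFiveToEightAtTwo`).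
HONEST FRAMING: Tate-algorithm bookkeeping in print; nothing about BSD or Manin's conjecture is proved; C2 OPEN.
[cite: SilvermanATAEC1994, IV.9.4 Step 7 and Table 4.1] [cite: Papadopoulos1993, Table IV (p = 2)]
-/

set_option autoImplicit false
-- lint-debt: the directory name repeats the summit name (sibling precedent `ManinLocalTwoThreeNegOneTwistConductorAtTwo.lean`)
set_option linter.dupNamespace false

noncomputable section

open scoped Classical
open Polynomial IsLocalRing WeierstrassCurve
open IsDiscreteValuationRing hiding maximalIdeal
open Literature.NumberTheory.DiophantineGeometry Literature.NumberTheory.DiophantineGeometry.TateAlgorithm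
  Literature.NumberTheory.DiophantineGeometry.TateAlgorithm.CharTwo

namespace Summit.BirchSwinnertonDyer.BirchSwinnertonDyer.Theorems.ManinLocalTwoThree

section TwoUniformizer

variable {R : Type*} [CommRing R] [IsDomain R] [IsDiscreteValuationRing R]

/-! ## §1 Exact values on the two exit shapes -/

/-- **Exact `ord Δ` at the first-test exit `n = 2m + 1`** (`2` a uniformiser): on `[2α, 2p, 2^{m+2}γ, 2^{m+3}q, 2^{2m+4}r]`, `p, γ ∈ Rˣ`:
`8` (`m = 0`); `2m + 9` (`m ≥ 1`, `α ∈ Rˣ`); `12` (`m = 1`, `2 ∣ α`); `2m + 11` (`m ≥ 2`, `2 ∣ α`) — the identities of the tree's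
`addVal_Δ_toNat_le_of_istarA`. [cite: SilvermanATAEC1994, IV.9.4 Step 7 and Table 4.1] [cite: Papadopoulos1993, Table IV (p = 2)] -/
theorem addVal_Δ_toNat_of_istarAForm (h2 : Irreducible (2 : R)) (V : WeierstrassCurve R) (m : ℕ)
    {α : R} (hα : V.a₁ = 2 * α) {p : R} (ha₂ : V.a₂ = 2 * p) (hp : IsUnit p) {γ : R}
    (ha₃ : V.a₃ = 2 ^ (m + 2) * γ) (hγ : IsUnit γ) (ha₄ : 2 ^ (m + 3) ∣ V.a₄)
    (ha₆ : 2 ^ (2 * m + 4) ∣ V.a₆) :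
    (m = 0 → (addVal R V.Δ).toNat = 8) ∧ (IsUnit α → 1 ≤ m → (addVal R V.Δ).toNat = 2 * m + 9) ∧
      (¬ IsUnit α → m = 1 → (addVal R V.Δ).toNat = 12) ∧ (¬ IsUnit α → 2 ≤ m → (addVal R V.Δ).toNat = 2 * m + 11) := by
  obtain ⟨q, hq⟩ := ha₄
  obtain ⟨r, hr⟩ := ha₆
  rcases m with _ | k
  · have e : V.Δ = 2 ^ 8 * (γ ^ 4 + 2 *
        (-2 * α ^ 6 * r + 2 * α ^ 5 * γ * q - α ^ 4 * p * γ ^ 2 - 12 * α ^ 4 * p * r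
       + 2 * α ^ 4 * q ^ 2 + 8 * α ^ 3 * p * γ * q + α ^ 3 * γ ^ 3 + 36 * α ^ 3 * γ * r
       - 4 * α ^ 2 * p ^ 2 * γ ^ 2 - 24 * α ^ 2 * p ^ 2 * r + 8 * α ^ 2 * p * q ^ 2
       - 30 * α ^ 2 * γ ^ 2 * q + 72 * α ^ 2 * q * r + 8 * α * p ^ 2 * γ * q
       + 18 * α * p * γ ^ 3 + 72 * α * p * γ * r - 96 * α * γ * q ^ 2 - 4 * p ^ 3 * γ ^ 2
       - 16 * p ^ 3 * r + 8 * p ^ 2 * q ^ 2 + 36 * p * γ ^ 2 * q + 144 * p * q * r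
       - 14 * γ ^ 4 - 108 * γ ^ 2 * r - 64 * q ^ 3 - 216 * r ^ 2)) := by
      simp only [WeierstrassCurve.Δ, WeierstrassCurve.b₂, WeierstrassCurve.b₄,
        WeierstrassCurve.b₆, WeierstrassCurve.b₈, hα, ha₂, ha₃, hq, hr]
      ring
    have hv := addVal_toNat_eq_of_two h2 (hγ.pow 4) e
    exact ⟨fun _ ↦ hv, fun _ h ↦ absurd h (by omega), fun _ h ↦ absurd h (by omega), fun _ h ↦ absurd h (by omega)⟩
  by_cases hαu : IsUnit α
  · have e : V.Δ = 2 ^ (2 * k + 11) * (α ^ 4 * p * γ ^ 2 + 2 *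
        (-α ^ 6 * r + α ^ 5 * γ * q - α ^ 4 * p * γ ^ 2 - 6 * α ^ 4 * p * r + α ^ 4 * q ^ 2
       + 4 * α ^ 3 * p * γ * q + α ^ 3 * γ ^ 3 * (2 ^ k : R)
       + 36 * α ^ 3 * γ * r * (2 ^ k : R) - 2 * α ^ 2 * p ^ 2 * γ ^ 2
       - 12 * α ^ 2 * p ^ 2 * r + 4 * α ^ 2 * p * q ^ 2
       - 30 * α ^ 2 * γ ^ 2 * q * (2 ^ k : R) + 72 * α ^ 2 * q * r * (2 ^ k : R)
       + 4 * α * p ^ 2 * γ * q + 18 * α * p * γ ^ 3 * (2 ^ k : R)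
       + 72 * α * p * γ * r * (2 ^ k : R) - 96 * α * γ * q ^ 2 * (2 ^ k : R)
       - 2 * p ^ 3 * γ ^ 2 - 8 * p ^ 3 * r + 4 * p ^ 2 * q ^ 2
       + 36 * p * γ ^ 2 * q * (2 ^ k : R) + 144 * p * q * r * (2 ^ k : R)
       - 27 * γ ^ 4 * (2 ^ k : R) ^ 2 - 216 * γ ^ 2 * r * (2 ^ k : R) ^ 2
       - 64 * q ^ 3 * (2 ^ k : R) - 432 * r ^ 2 * (2 ^ k : R) ^ 2)) := by
      simp only [WeierstrassCurve.Δ, WeierstrassCurve.b₂, WeierstrassCurve.b₄,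
        WeierstrassCurve.b₆, WeierstrassCurve.b₈, hα, ha₂, ha₃, hq, hr]
      ring
    have hv := addVal_toNat_eq_of_two h2 (((hαu.pow 4).mul hp).mul (hγ.pow 2)) e
    exact ⟨fun h ↦ absurd h (by omega), fun _ _ ↦ by omega, fun h _ ↦ absurd hαu h, fun h _ ↦ absurd hαu h⟩
  obtain ⟨α₁, hα₁⟩ := (not_isUnit_iff_dvd h2 _).mp hαu
  rcases k with _ | k
  · have e : V.Δ = 2 ^ 12 * (γ ^ 4 + 2 *
        (-p ^ 3 * γ ^ 2 - 4 * p ^ 3 * r - 4 * p ^ 2 * γ ^ 2 * α₁ ^ 2 + 4 * p ^ 2 * γ * q * α₁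
       + 2 * p ^ 2 * q ^ 2 - 24 * p ^ 2 * r * α₁ ^ 2 + 18 * p * γ ^ 3 * α₁
       + 18 * p * γ ^ 2 * q - 4 * p * γ ^ 2 * α₁ ^ 4 + 16 * p * γ * q * α₁ ^ 3
       + 72 * p * γ * r * α₁ + 8 * p * q ^ 2 * α₁ ^ 2 + 72 * p * q * r - 48 * p * r * α₁ ^ 4
       - 14 * γ ^ 4 + 4 * γ ^ 3 * α₁ ^ 3 - 60 * γ ^ 2 * q * α₁ ^ 2 - 108 * γ ^ 2 * r
       - 96 * γ * q ^ 2 * α₁ + 16 * γ * q * α₁ ^ 5 + 144 * γ * r * α₁ ^ 3 - 32 * q ^ 3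
       + 8 * q ^ 2 * α₁ ^ 4 + 144 * q * r * α₁ ^ 2 - 216 * r ^ 2 - 32 * r * α₁ ^ 6)) := by
      simp only [WeierstrassCurve.Δ, WeierstrassCurve.b₂, WeierstrassCurve.b₄,
        WeierstrassCurve.b₆, WeierstrassCurve.b₈, hα, ha₂, ha₃, hq, hr, hα₁]
      ring
    have hv := addVal_toNat_eq_of_two h2 (hγ.pow 4) e
    exact ⟨fun h ↦ absurd h (by omega), fun h _ ↦ absurd h hαu, fun _ _ ↦ hv, fun _ h ↦ absurd h (by omega)⟩
  · have e : V.Δ = 2 ^ (2 * k + 15) * (p ^ 3 * γ ^ 2 + 2 *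
        (-p ^ 3 * γ ^ 2 - 2 * p ^ 3 * r - 2 * p ^ 2 * γ ^ 2 * α₁ ^ 2 + 2 * p ^ 2 * γ * q * α₁
       + p ^ 2 * q ^ 2 - 12 * p ^ 2 * r * α₁ ^ 2 + 18 * p * γ ^ 3 * (2 ^ k : R) * α₁
       + 18 * p * γ ^ 2 * q * (2 ^ k : R) - 2 * p * γ ^ 2 * α₁ ^ 4 + 8 * p * γ * q * α₁ ^ 3
       + 72 * p * γ * r * (2 ^ k : R) * α₁ + 4 * p * q ^ 2 * α₁ ^ 2
       + 72 * p * q * r * (2 ^ k : R) - 24 * p * r * α₁ ^ 4 - 27 * γ ^ 4 * (2 ^ k : R) ^ 2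
       + 4 * γ ^ 3 * (2 ^ k : R) * α₁ ^ 3 - 60 * γ ^ 2 * q * (2 ^ k : R) * α₁ ^ 2
       - 216 * γ ^ 2 * r * (2 ^ k : R) ^ 2 - 96 * γ * q ^ 2 * (2 ^ k : R) * α₁
       + 8 * γ * q * α₁ ^ 5 + 144 * γ * r * (2 ^ k : R) * α₁ ^ 3 - 32 * q ^ 3 * (2 ^ k : R)
       + 4 * q ^ 2 * α₁ ^ 4 + 144 * q * r * (2 ^ k : R) * α₁ ^ 2
       - 432 * r ^ 2 * (2 ^ k : R) ^ 2 - 16 * r * α₁ ^ 6)) := by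
      simp only [WeierstrassCurve.Δ, WeierstrassCurve.b₂, WeierstrassCurve.b₄,
        WeierstrassCurve.b₆, WeierstrassCurve.b₈, hα, ha₂, ha₃, hq, hr, hα₁]
      ring
    have hv := addVal_toNat_eq_of_two h2 ((hp.pow 3).mul (hγ.pow 2)) e
    exact ⟨fun h ↦ absurd h (by omega), fun h _ ↦ absurd h hαu, fun _ h ↦ absurd h (by omega), fun _ _ ↦ by omega⟩

/-- **Exact `ord Δ` at the second-test exit `n = 2m + 2`** (`2` a uniformiser): on `[2α, 2p, 2^{m+3}γ, 2^{m+3}q, 2^{2m+5}r]`, `p, q ∈ Rˣ`: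
`2m + 10` (`α ∈ Rˣ`); `2m + 12` (`m ≥ 1`, `2 ∣ α`); `12` or `13` (`m = 0`, `2 ∣ α`) — the identities of the tree's `addVal_Δ_toNat_le_of_istarB`.
[cite: SilvermanATAEC1994, IV.9.4 Step 7 and Table 4.1] [cite: Papadopoulos1993, Table IV (p = 2)] -/
theorem addVal_Δ_toNat_of_istarBForm (h2 : Irreducible (2 : R)) (V : WeierstrassCurve R) (m : ℕ)
    {α : R} (hα : V.a₁ = 2 * α) {p : R} (ha₂ : V.a₂ = 2 * p) (hp : IsUnit p)
    (ha₃ : 2 ^ (m + 3) ∣ V.a₃) {q : R} (ha₄ : V.a₄ = 2 ^ (m + 3) * q) (hq : IsUnit q)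
    (ha₆ : 2 ^ (2 * m + 5) ∣ V.a₆) :
    (IsUnit α → (addVal R V.Δ).toNat = 2 * m + 10) ∧ (¬ IsUnit α → 1 ≤ m → (addVal R V.Δ).toNat = 2 * m + 12) ∧
      (¬ IsUnit α → m = 0 → (addVal R V.Δ).toNat = 12 ∨ (addVal R V.Δ).toNat = 13) := by
  obtain ⟨γ, hγ⟩ := ha₃
  obtain ⟨r, hr⟩ := ha₆
  by_cases hαu : IsUnit α
  · have e : V.Δ = 2 ^ (2 * m + 10) * (α ^ 4 * q ^ 2 + 2 *
        (-α ^ 6 * r + α ^ 5 * γ * q - α ^ 4 * p * γ ^ 2 - 6 * α ^ 4 * p * r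
       + 4 * α ^ 3 * p * γ * q + 2 * α ^ 3 * γ ^ 3 * (2 ^ m : R)
       + 36 * α ^ 3 * γ * r * (2 ^ m : R) - 4 * α ^ 2 * p ^ 2 * γ ^ 2
       - 12 * α ^ 2 * p ^ 2 * r + 2 * α ^ 2 * p * q ^ 2
       - 30 * α ^ 2 * γ ^ 2 * q * (2 ^ m : R) + 36 * α ^ 2 * q * r * (2 ^ m : R)
       + 4 * α * p ^ 2 * γ * q + 36 * α * p * γ ^ 3 * (2 ^ m : R)
       + 72 * α * p * γ * r * (2 ^ m : R) - 48 * α * γ * q ^ 2 * (2 ^ m : R)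
       - 4 * p ^ 3 * γ ^ 2 - 8 * p ^ 3 * r + 2 * p ^ 2 * q ^ 2
       + 36 * p * γ ^ 2 * q * (2 ^ m : R) + 72 * p * q * r * (2 ^ m : R)
       - 54 * γ ^ 4 * (2 ^ m : R) ^ 2 - 216 * γ ^ 2 * r * (2 ^ m : R) ^ 2
       - 16 * q ^ 3 * (2 ^ m : R) - 216 * r ^ 2 * (2 ^ m : R) ^ 2)) := by
      simp only [WeierstrassCurve.Δ, WeierstrassCurve.b₂, WeierstrassCurve.b₄,
        WeierstrassCurve.b₆, WeierstrassCurve.b₈, hα, ha₂, hγ, ha₄, hr]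
      ring
    have hv := addVal_toNat_eq_of_two h2 ((hαu.pow 4).mul (hq.pow 2)) e
    exact ⟨fun _ ↦ hv, fun h _ ↦ absurd hαu h, fun h _ ↦ absurd hαu h⟩
  obtain ⟨α₁, hα₁⟩ := (not_isUnit_iff_dvd h2 _).mp hαu
  rcases m with _ | k
  · by_cases hγu : IsUnit γ
    · by_cases hT : IsUnit ((p + 2 * α₁ ^ 2) * q + γ ^ 2 + 2 * r)
      · have e : V.Δ = 2 ^ 12 * (((p + 2 * α₁ ^ 2) * q + γ ^ 2 + 2 * r) ^ 2 + 2 *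
            (-p ^ 3 * γ ^ 2 - 2 * p ^ 3 * r - 4 * p ^ 2 * γ ^ 2 * α₁ ^ 2
           + 2 * p ^ 2 * γ * q * α₁ - 12 * p ^ 2 * r * α₁ ^ 2 + 18 * p * γ ^ 3 * α₁
           + 8 * p * γ ^ 2 * q - 4 * p * γ ^ 2 * α₁ ^ 4 + 8 * p * γ * q * α₁ ^ 3
           + 36 * p * γ * r * α₁ + 16 * p * q * r - 24 * p * r * α₁ ^ 4 - 14 * γ ^ 4
           + 4 * γ ^ 3 * α₁ ^ 3 - 32 * γ ^ 2 * q * α₁ ^ 2 - 56 * γ ^ 2 * r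
           - 24 * γ * q ^ 2 * α₁ + 8 * γ * q * α₁ ^ 5 + 72 * γ * r * α₁ ^ 3 - 4 * q ^ 3
           + 32 * q * r * α₁ ^ 2 - 56 * r ^ 2 - 16 * r * α₁ ^ 6)) := by
          simp only [WeierstrassCurve.Δ, WeierstrassCurve.b₂, WeierstrassCurve.b₄,
            WeierstrassCurve.b₆, WeierstrassCurve.b₈, hα, ha₂, hγ, ha₄, hr, hα₁]
          ring
        have hv := addVal_toNat_eq_of_two h2 (hT.pow 2) e
        exact ⟨fun h ↦ absurd h hαu, fun _ h ↦ absurd h (by omega), fun _ _ ↦ Or.inl hv⟩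
      obtain ⟨s, hs⟩ := (not_isUnit_iff_dvd h2 _).mp hT
      have hs' : p * q = 2 * s - 2 * α₁ ^ 2 * q - γ ^ 2 - 2 * r := by linear_combination hs
      have e : q ^ 3 * V.Δ = 2 ^ 13 * (γ ^ 8 + 2 *
          (γ ^ 6 * q * α₁ ^ 2 + 4 * γ ^ 6 * r - 3 * γ ^ 6 * s - 8 * γ ^ 5 * q ^ 2 * α₁
         - 11 * γ ^ 4 * q ^ 3 + 4 * γ ^ 4 * q * r * α₁ ^ 2 - 4 * γ ^ 4 * q * α₁ ^ 2 * s
         + 12 * γ ^ 4 * r ^ 2 - 18 * γ ^ 4 * r * s + 6 * γ ^ 4 * s ^ 2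
         - 16 * γ ^ 3 * q ^ 3 * α₁ ^ 3 - 32 * γ ^ 3 * q ^ 2 * r * α₁
         + 14 * γ ^ 3 * q ^ 2 * α₁ * s - 24 * γ ^ 2 * q ^ 4 * α₁ ^ 2
         - 44 * γ ^ 2 * q ^ 3 * r + 8 * γ ^ 2 * q ^ 3 * s + 4 * γ ^ 2 * q * r ^ 2 * α₁ ^ 2
         - 8 * γ ^ 2 * q * r * α₁ ^ 2 * s + 4 * γ ^ 2 * q * α₁ ^ 2 * s ^ 2
         + 16 * γ ^ 2 * r ^ 3 - 36 * γ ^ 2 * r ^ 2 * s + 24 * γ ^ 2 * r * s ^ 2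
         - 4 * γ ^ 2 * s ^ 3 - 12 * γ * q ^ 5 * α₁ - 32 * γ * q ^ 2 * r ^ 2 * α₁
         + 28 * γ * q ^ 2 * r * α₁ * s + 4 * γ * q ^ 2 * α₁ * s ^ 2 - 2 * q ^ 6
         - 44 * q ^ 3 * r ^ 2 + 16 * q ^ 3 * r * s + q ^ 3 * s ^ 2 + 8 * r ^ 4
         - 24 * r ^ 3 * s + 24 * r ^ 2 * s ^ 2 - 8 * r * s ^ 3)) := by
        simp only [WeierstrassCurve.Δ, WeierstrassCurve.b₂, WeierstrassCurve.b₄,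
          WeierstrassCurve.b₆, WeierstrassCurve.b₈, hα, ha₂, hγ, ha₄, hr, hα₁]
        linear_combination
          (-8192 * p ^ 2 * γ ^ 2 * q ^ 2 - 16384 * p ^ 2 * q ^ 2 * r + 8192 * p * γ ^ 4 * q
          - 16384 * p * γ ^ 2 * q ^ 2 * α₁ ^ 2 + 32768 * p * γ ^ 2 * q * r
          - 16384 * p * γ ^ 2 * q * s + 16384 * p * γ * q ^ 3 * α₁ + 4096 * p * q ^ 4
          - 65536 * p * q ^ 2 * r * α₁ ^ 2 + 32768 * p * q * r ^ 2 - 32768 * p * q * r * s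
          - 8192 * γ ^ 6 - 49152 * γ ^ 4 * r + 32768 * γ ^ 4 * s
          + 131072 * γ ^ 3 * q ^ 2 * α₁ + 69632 * γ ^ 2 * q ^ 3
          + 32768 * γ ^ 2 * q * r * α₁ ^ 2 - 98304 * γ ^ 2 * r ^ 2 + 131072 * γ ^ 2 * r * s
          - 32768 * γ ^ 2 * s ^ 2 + 32768 * γ * q ^ 3 * α₁ ^ 3 + 262144 * γ * q ^ 2 * r * α₁
          + 32768 * γ * q ^ 2 * α₁ * s + 8192 * q ^ 4 * α₁ ^ 2 + 139264 * q ^ 3 * r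
          + 8192 * q ^ 3 * s - 65536 * q ^ 2 * r * α₁ ^ 4 + 65536 * q * r ^ 2 * α₁ ^ 2
          - 65536 * q * r * α₁ ^ 2 * s - 65536 * r ^ 3 + 131072 * r ^ 2 * s
          - 65536 * r * s ^ 2) * hs'
      have hv := addVal_toNat_eq_of_eq_add h2 (hq.pow 3) (hγu.pow 8) e
      exact ⟨fun h ↦ absurd h hαu, fun _ h ↦ absurd h (by omega), fun _ _ ↦ Or.inr hv⟩
    obtain ⟨γ₁, hγ₁⟩ := (not_isUnit_iff_dvd h2 _).mp hγu
    have e : V.Δ = 2 ^ 12 * ((p * q) ^ 2 + 2 *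
        (-2 * p ^ 3 * r - 4 * p ^ 3 * γ₁ ^ 2 + 4 * p ^ 2 * q * α₁ * γ₁
       - 12 * p ^ 2 * r * α₁ ^ 2 - 16 * p ^ 2 * α₁ ^ 2 * γ₁ ^ 2 + 2 * p * q ^ 2 * α₁ ^ 2
       + 18 * p * q * r + 16 * p * q * α₁ ^ 3 * γ₁ + 36 * p * q * γ₁ ^ 2
       - 24 * p * r * α₁ ^ 4 + 72 * p * r * α₁ * γ₁ - 16 * p * α₁ ^ 4 * γ₁ ^ 2
       + 144 * p * α₁ * γ₁ ^ 3 - 4 * q ^ 3 + 2 * q ^ 2 * α₁ ^ 4 - 48 * q ^ 2 * α₁ * γ₁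
       + 36 * q * r * α₁ ^ 2 + 16 * q * α₁ ^ 5 * γ₁ - 120 * q * α₁ ^ 2 * γ₁ ^ 2 - 54 * r ^ 2
       - 16 * r * α₁ ^ 6 + 144 * r * α₁ ^ 3 * γ₁ - 216 * r * γ₁ ^ 2 + 32 * α₁ ^ 3 * γ₁ ^ 3
       - 216 * γ₁ ^ 4)) := by
      simp only [WeierstrassCurve.Δ, WeierstrassCurve.b₂, WeierstrassCurve.b₄,
        WeierstrassCurve.b₆, WeierstrassCurve.b₈, hα, ha₂, hγ, ha₄, hr, hα₁, hγ₁]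
      ring
    have hv := addVal_toNat_eq_of_two h2 ((hp.mul hq).pow 2) e
    exact ⟨fun h ↦ absurd h hαu, fun _ h ↦ absurd h (by omega), fun _ _ ↦ Or.inl hv⟩
  · have e : V.Δ = 2 ^ (2 * k + 14) * ((p * q) ^ 2 + 2 *
        (-p ^ 3 * γ ^ 2 - 2 * p ^ 3 * r - 4 * p ^ 2 * γ ^ 2 * α₁ ^ 2 + 2 * p ^ 2 * γ * q * α₁
       - 12 * p ^ 2 * r * α₁ ^ 2 + 36 * p * γ ^ 3 * (2 ^ k : R) * α₁
       + 18 * p * γ ^ 2 * q * (2 ^ k : R) - 4 * p * γ ^ 2 * α₁ ^ 4 + 8 * p * γ * q * α₁ ^ 3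
       + 72 * p * γ * r * (2 ^ k : R) * α₁ + 2 * p * q ^ 2 * α₁ ^ 2
       + 36 * p * q * r * (2 ^ k : R) - 24 * p * r * α₁ ^ 4 - 54 * γ ^ 4 * (2 ^ k : R) ^ 2
       + 8 * γ ^ 3 * (2 ^ k : R) * α₁ ^ 3 - 60 * γ ^ 2 * q * (2 ^ k : R) * α₁ ^ 2
       - 216 * γ ^ 2 * r * (2 ^ k : R) ^ 2 - 48 * γ * q ^ 2 * (2 ^ k : R) * α₁
       + 8 * γ * q * α₁ ^ 5 + 144 * γ * r * (2 ^ k : R) * α₁ ^ 3 - 8 * q ^ 3 * (2 ^ k : R)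
       + 2 * q ^ 2 * α₁ ^ 4 + 72 * q * r * (2 ^ k : R) * α₁ ^ 2
       - 216 * r ^ 2 * (2 ^ k : R) ^ 2 - 16 * r * α₁ ^ 6)) := by
      simp only [WeierstrassCurve.Δ, WeierstrassCurve.b₂, WeierstrassCurve.b₄,
        WeierstrassCurve.b₆, WeierstrassCurve.b₈, hα, ha₂, hγ, ha₄, hr, hα₁]
      ring
    have hv := addVal_toNat_eq_of_two h2 ((hp.mul hq).pow 2) e
    exact ⟨fun h ↦ absurd h hαu, fun _ _ ↦ by omega, fun _ h ↦ absurd h (by omega)⟩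

/-! ## §2 The value sets of type `Iₙ*`, `n ≥ 1` -/

/-- **Papadopoulos' menu for `Iₙ*` at `2`** (`2` a uniformiser, perfect residue field): if Tate's algorithm returns `Istar n`, `n ≥ 1`, then
`ord Δ = 8` (`n = 1`); `ord Δ ∈ {10, 12, 13}` (`n = 2`); `ord Δ ∈ {11, 12}` (`n = 3`); `ord Δ ∈ {n + 8, n + 10}` (`n ≥ 4`).
[cite: Papadopoulos1993, Table IV (p = 2)] [cite: SilvermanATAEC1994, IV.9.4 Step 7 and Table 4.1] -/
theorem addVal_Δ_toNat_eq_of_kodairaSymbolOfMinimal_eq_Istar_of_two [PerfectField (ResidueField R)] (h2 : Irreducible (2 : R))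
    (V : WeierstrassCurve R) {n : ℕ} (hV : V.kodairaSymbolOfMinimal = .Istar n) (hn : n ≠ 0) :
    (n = 1 ∧ (addVal R V.Δ).toNat = 8) ∨
      (n = 2 ∧ ((addVal R V.Δ).toNat = 10 ∨ (addVal R V.Δ).toNat = 12 ∨ (addVal R V.Δ).toNat = 13)) ∨
      (n = 3 ∧ ((addVal R V.Δ).toNat = 11 ∨ (addVal R V.Δ).toNat = 12)) ∨
      (4 ≤ n ∧ ((addVal R V.Δ).toNat = n + 8 ∨ (addVal R V.Δ).toNat = n + 10)) := by
  obtain ⟨D, hu, h₁, h₂, h₂n, hbr⟩ := exists_smul_deep_of_kodairaSymbolOfMinimal_eq_Istar h2 V hV hn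
  have hm : ∀ {x : R}, x ∈ maximalIdeal R ↔ (2 : R) ∣ x := fun {x} ↦ mem_maximalIdeal_iff_dvd_of_irreducible h2 x
  have hmn : ∀ {x : R} {n : ℕ}, x ∈ maximalIdeal R ^ n ↔ (2 : R) ^ n ∣ x := fun {x n} ↦
    mem_maximalIdeal_pow_iff_dvd_of_irreducible h2 x n
  obtain ⟨α, hα⟩ := hm.mp h₁
  obtain ⟨p, hp⟩ := hm.mp h₂
  have hpu : IsUnit p := by
    rw [isUnit_iff_not_dvd h2]
    rintro ⟨p', hp'⟩
    exact h₂n (hmn.mpr ⟨p', by rw [hp, hp']; ring⟩)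
  rw [← Δ_smul_of_u_eq_one hu V]
  rcases hbr with ⟨k, hnk, h₃, h₃n, h₄, h₆⟩ | ⟨k, hnk, h₃, h₄, h₄n, h₆⟩
  · -- first-test exit `n = 2k + 1`
    obtain ⟨γ, hγ⟩ := hmn.mp h₃
    have hγu : IsUnit γ := by
      rw [isUnit_iff_not_dvd h2]
      rintro ⟨γ', hγ'⟩
      exact h₃n (hmn.mpr ⟨γ', by rw [hγ, hγ']; ring⟩)
    obtain ⟨e0, eu, e1, e2⟩ := addVal_Δ_toNat_of_istarAForm h2 (D • V) k hα hp hpu hγ hγu (hmn.mp h₄) (hmn.mp h₆)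
    by_cases hαu : IsUnit α
    · rcases Nat.lt_or_ge k 1 with hk | hk
      · exact Or.inl ⟨by omega, e0 (by omega)⟩
      rcases Nat.lt_or_ge k 2 with hk' | hk'
      · exact Or.inr (Or.inr (Or.inl ⟨by omega, Or.inl (by have := eu hαu hk; omega)⟩))
      · exact Or.inr (Or.inr (Or.inr ⟨by omega, Or.inl (by have := eu hαu hk; omega)⟩))
    · rcases Nat.lt_or_ge k 1 with hk | hk
      · exact Or.inl ⟨by omega, e0 (by omega)⟩
      rcases Nat.lt_or_ge k 2 with hk' | hk'
      · exact Or.inr (Or.inr (Or.inl ⟨by omega, Or.inr (e1 hαu (by omega))⟩))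
      · exact Or.inr (Or.inr (Or.inr ⟨by omega, Or.inr (by have := e2 hαu hk'; omega)⟩))
  · -- second-test exit `n = 2k + 2`
    obtain ⟨q, hq⟩ := hmn.mp h₄
    have hqu : IsUnit q := by
      rw [isUnit_iff_not_dvd h2]
      rintro ⟨q', hq'⟩
      exact h₄n (hmn.mpr ⟨q', by rw [hq, hq']; ring⟩)
    obtain ⟨eu, e1, e0⟩ := addVal_Δ_toNat_of_istarBForm h2 (D • V) k hα hp hpu (hmn.mp h₃) hq hqu (hmn.mp h₆)
    by_cases hαu : IsUnit α
    · rcases Nat.lt_or_ge k 1 with hk | hk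
      · exact Or.inr (Or.inl ⟨by omega, Or.inl (by have := eu hαu; omega)⟩)
      · exact Or.inr (Or.inr (Or.inr ⟨by omega, Or.inl (by have := eu hαu; omega)⟩))
    · rcases Nat.lt_or_ge k 1 with hk | hk
      · rcases e0 hαu (by omega) with h | h
        · exact Or.inr (Or.inl ⟨by omega, Or.inr (Or.inl h)⟩)
        · exact Or.inr (Or.inl ⟨by omega, Or.inr (Or.inr h)⟩)
      · exact Or.inr (Or.inr (Or.inr ⟨by omega, Or.inr (by have := e1 hαu hk; omega)⟩))

end TwoUniformizer

end Summit.BirchSwinnertonDyer.BirchSwinnertonDyer.Theorems.ManinLocalTwoThree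

end
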